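import Summits.BirchSwinnertonDyer.BirchSwinnertonDyer.Theorems.ErratumRoadFiveEulerHalfUBLinks
import Summits.BirchSwinnertonDyer.BirchSwinnertonDyer.Theorems.ClassRecordThreeIMCDivAtThreeB
import Summits.BirchSwinnertonDyer.BirchSwinnertonDyer.Theorems.ClassRecordThreeStepLOfHalvesB
import Summits.BirchSwinnertonDyer.BirchSwinnertonDyer.Theorems.ErratumRoadFiveControlFromJSWMult
import Summits.BirchSwinnertonDyer.Rank1Residual.X11b.TamagawaHeegnerExact
import Summits.BirchSwinnertonDyer.Rank1Residual.X11b.BDPRouteEndState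
import HarnessLib

/-!
# Routes `ClassRecordThree` (K2@3) and `KolyvaginRoadThree`, crux `EulerHalvesAtThree` (item stmt-BirchSwinnertonDyer-19109):
# the Euler-system half at `p = 3` — ALL THREE CLAUSES, Tamagawa-INCLUSIVE — from the ES inclusion of the BDP main
# conjecture at `3 ∥ N` (UB∃ᴮ@3) ∘ the LZZ value at `𝟙` ∘ the JSW control identity (the `p = 3` twin of bdp g19's
# `ErratumRoadFiveEulerHalfFromUB`)

Cell `bsd-stepL` (run/shared/lean/pub/bsd-stepL/), seat `bsd-stepL-bdp` (prover g19, 2026-08-27).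
`--supports stmt-BirchSwinnertonDyer-19109 --as helper`. THEOREMS ONLY; THESES-FREE (the by-name wrapper for the two
route decls is `Theorems/ClassRecordThreeEulerHalvesAtThreeOfUB.lean`). Memo: HOME/proof/PROOF-BDP.md §45 (the
p ≥ 5 road) and §47 (this twin).

WHY. Item 19109's text: «no printed upper bound at 3 absorbs Tamagawa factors»; tam3-p1's kernel census: «J₃ asks
divisibility to depth t = ord₃ ∏c — the SUM; every Kolyvagin-system method in print yields the MAXIMUM max_q ord₃ c_q
only; the sum is known in print only through an anticyclotomic main conjecture (BCGS23 Thm. 2, good ordinary p > 3)».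
The UB road IS that main-conjecture mechanism at `p ∥ N`: UB ∘ value ∘ control give
`ord_p #Ш(E∕K) + 2·ord_p ∏_ℓ c_ℓ(E) ≤ 2·ord_p [E(K):ℤP]` — the SUM — uniformly in the carrier count (bdp g19 p524850,
every `p`). At `p = 3` the value at `𝟙` is now a THEOREM for every X11b@3 curve from the refereed Liu–Zhang–Zhang fact
(thmc-p1 g8 p526437 `Three.bdpValueAt₃_of_thm151_thm153`, plan g32 RULING 18), and the control identity at a
multiplicative `p ≥ 3` is the published JSW fact (imc-t1 `controlOnTreeAt_of_thm331Mult_embAt`, `3 ≤ p` allowed).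

## The typed input UB∃ᴮ@3 (inline; no definition)

Over x11b3's S0 datum (binders VERBATIM those of `Three.BDPExistsAt₃` ∕ `Three.BDPValueAt₃` ∕ `Three.IMCDivAt₃B`): for every
degree-one `𝔭 ∋ 3` and the newform `f` of `E` THERE IS an embedding datum `ι'` inducing `𝔭` and an `R₀`-frame
`(Ω_K ≠ 0, Ω_p ∈ R₀ˣ, L ∈ R₀⟦T⟧)` with Castella's interpolation property at `(ι', 𝔭)` (this far = `Three.BDPExistsAt₃ W`, H1)
AND, for every prime `𝔭bar ∋ 3` with `𝔭bar ≠ 𝔭`, the EULER-SYSTEM INCLUSION `(L) ⊆ Ch_Λ(X_ac^∅ 𝔭bar)·R₀⟦T⟧` — the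
oriented atom `Three.IMCDivAt₃B` with the inclusion REVERSED and the frame existentially quantified. SOURCELESS at
`p = 3` as mathematics (the cell's memo proof of UB, PROOF-BDP §38–§41, is `p ≥ 5`: JIMJ18's ERL is `p ≥ 5`, the
Katz-at-3 port π2 is open); TYPED here so that the @3 routes can name the object.

## What this file proves

* §0 `shaIndexBoundSharp_of_heegner_prime` — p524850's `shaIndexBoundSharp_of_heegner` WITHOUT `5 ≤ p` (the Tamagawa
  transport at a classical Heegner field holds at every prime: `…_of_heegner_prime` lemmas of `TamagawaHeegnerExact`).
* §1 `shaIndexBoundSharp_of_ubB₃_at_datum` — AT ONE S0 datum: UB∃ᴮ@3 + `Three.BDPValueAt₃ W` + `h331` + Kolyvagin ⟹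
  `ord₃ #Ш(E∕K) + 2·ord₃ ∏c(E) ≤ 2·ord₃ [E(K):ℤP]`. Plumbing: any degree-one `𝔭 ∋ 3` (3 splits); UB∃ᴮ@3 gives
  `ι'`, the frame `L` and `(L) ⊆ Ch(X_ac 𝔭₁)·R₀⟦T⟧` at the OTHER prime `𝔭₁`; the value `L(𝟙) = u((1 − a₃∕3)·log_𝔭 P)²`
  (read at `P` through `embAt 𝔭` — no Galois conjugate needed at 3); everything read in `𝓞_{ℂ_3}⟦T⟧`
  (`R1.unrToCpInt`, `R1.map_toCpInt_eq_comp`, `R1.intSeries_hasValueAt_map_iff`); p524850's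
  `charValuation_le_of_span_le_of_intValue`; control at `(𝔭₁, embAt 𝔭₁, P)`; log symmetry `𝔭 ↔ 𝔭₁` in rank one.
* §2 `missingUpperBoundAt_three_of_classX11b_of_ram_of_ubB₃` — X11b@3 ∧ (ram): `Typed.MissingUpperBoundAt W 3` from
  UB∃ᴮ@3 + H2@3 + PUBLISHED facts (`h331`, GZ, Kolyvagin, Skinner Thm C at 3 for the twist, GZK, modularity ×2,
  Hoffstein–Luo, Mazur) — BOTH (ram) clauses of the crux ((α) and (γ∖α)), their shape binders unused.
* (part 2, `…FromUBNotRam.lean`) §3 `missingUpperBoundAt_three_of_classX11b_of_surj_of_ubB₃_of_twistLower` — X11b@3 ∧ surj: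
  the same with the twist's `≥`-half from TL₃ = the registered stub `stub_twistLowerAtThree` of 19109's birth skeleton VERBATIM
  (shared with tam3-p1's line).
* (part 2) §4 `eulerHalvesAtThree_body_of_ubB₃` — the BODY of `EulerHalvesAtThree` (identical on both routes) VERBATIM from
  {UB∃ᴮ@3 on X11b@3, H2@3 on X11b@3, h331, the nine published facts, TL₃}.

HONEST FRAMING: implications only. UB∃ᴮ@3 has NO source at `p = 3` (not even the cell's memo); TL₃ is an open stub;
H2@3 is a theorem modulo ONE refereed fact (LZZ18). Nothing is discharged, booked or re-labelled (T7); BSD is proved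
for no curve; item 19109 is NOT closed. A SECOND road next to tam3-p1's registered Jetchev line, not a replacement.

References: [JetchevSkinnerWan2017] Thm. 3.3.1 with §3.5 (3.5.c), §7.4.2; [Castella2018] Thms. 2.3, 3.1, 3.2, §5;
[LiuZhangZhang2018] Thms. 1.5.1, 1.5.3; [Skinner2016PacificMC] Thm. C; [Jetchev2008] Thm. 1.4; [BCGS2023] Thm. 2
(the printed sum-form at good p); [Miller2011LMS] Def. 1.1.
-/

set_option autoImplicit false
set_option linter.dupNamespace false

noncomputable section

open scoped Classical NumberField

open WeierstrassCurve NumberField IsDedekindDomain Field PowerSeries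
open Literature.NumberTheory.EllipticCurves Literature.NumberTheory.EllipticCurves.GreenbergSelmer
open Literature.NumberTheory.EllipticCurves.ModularForms
open Literature.NumberTheory.EllipticCurves.Rank1Residual
open Literature.NumberTheory.EllipticCurves.Rank1Residual.Typed
open Literature.NumberTheory.EllipticCurves.JetchevSkinnerWan2017
open Literature.NumberTheory.GaloisRepresentations Literature.NumberTheory.GaloisCohomology
open Literature.NumberTheory.Automorphic
open Summit.BirchSwinnertonDyer.Rank1Residual Summit.BirchSwinnertonDyer.Rank1Residual.X11b
open Summit.BirchSwinnertonDyer.Rank1Residual.X11b.AcSelmer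
open Summit.BirchSwinnertonDyer.Rank1Residual.X11b.CongruenceLimit
open Summit.BirchSwinnertonDyer.Rank1Residual.X11b.Halves
open Summit.BirchSwinnertonDyer.Rank1Residual.X11b.Three
open Summit.BirchSwinnertonDyer.BirchSwinnertonDyer.Theorems.SchneiderFreeAdditiveX3

namespace Summit.BirchSwinnertonDyer.BirchSwinnertonDyer.Theorems.EulerHalfUB

/-! ### §0 The sharp bound over a classical Heegner field at EVERY prime -/

section Control

variable {K : Type} [Field K] [NumberField K] {W : WeierstrassCurve ℚ} [W.IsElliptic]
  [W.IsGloballyMinimal] {p : ℕ} [Fact p.Prime] {ι : K →+* ℚ_[p]}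
  {P : (W.baseChange K).toAffine.Point}
  {κ : ZpExtension K p} {𝔮 : HeightOneSpectrum (𝓞 K)} {γ : Field.absoluteGaloisGroup K}
  [Fact (κ.IsTopGenerator γ)]

/-- **`ord_p #Ш(E/K) + 2·ord_p ∏_ℓ c_ℓ(E) ≤ 2·ord_p [E(K):ℤP]` at a classical Heegner field, EVERY prime `p`** — the
`p`-unrestricted form of `shaIndexBoundSharp_of_heegner` (the Tamagawa transport `∏_{w∣N⁺} c_w = ∏_w c_w(E/K)`,
`ord_p ∏_w c_w(E/K) = 2·ord_p ∏_ℓ c_ℓ(E)` holds at every prime: `padicValNat_tamagawaProductSplit_eq_of_heegner_prime`,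
`padicValNat_tamagawaProduct_baseChange_of_heegner_prime`). CONDITIONAL on the shapes.
[cite: JetchevSkinnerWan2017, §7.3.1 (eq:tamK) and §7.4.2 (arXiv:1512.06894 pp. 30–31)]
[cite: Castella2018, Thm. 2.3 (p. 5), §5 (5.2)–(5.3) (p. 12)] -/
theorem shaIndexBoundSharp_of_heegner_prime (hK : IsImaginaryQuadratic K) {N : ℕ}
    (hN : W.conductorNorm ℤ = N) (hH : SatisfiesHeegnerHypothesis N K) [Finite (W.baseChange K).sha]
    {n : ℕ} (hn : XAc.HasCharValuationAt (W.baseChange K) p κ 𝔮 ∅ γ n)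
    (hle : (n : ℤ) ≤ 2 * (X11b.padicLogOrd W p ι P - 1)) (hCTL : ControlOnTreeAt p κ 𝔮 γ ι P) :
    padicValNat p (W.baseChange K).shaOrder + 2 * padicValNat p W.tamagawaProduct ≤
      2 * padicValNat p (AddSubgroup.zmultiples P).index := by
  haveI : Finite (AddCommGroup.primaryComponent (W.baseChange K).sha p) :=
    Finite.of_injective _ Subtype.val_injective
  have h := sha_add_tamagawaProductSplit_le_of_control hn hle hCTL
  rw [padicValNat_tamagawaProductSplit_eq_of_heegner_prime W K p hN hH,
    padicValNat_tamagawaProduct_baseChange_of_heegner_prime W K p hK hN hH,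
    padicValNat_card_addPrimaryComponent] at h
  rw [WeierstrassCurve.shaOrder]
  omega

end Control

/-! ### §1 AT ONE S0 DATUM at `p = 3`: UB∃ᴮ@3 + H2@3 + the JSW control fact ⟹ the sharp bound over `K` -/

section Datum

variable {W : WeierstrassCurve ℚ} [W.IsElliptic] [W.IsGloballyMinimal]

/-- **The SHARP bound `ord₃ #Ш(E/K) + 2·ord₃ ∏_ℓ c_ℓ(E) ≤ 2·ord₃ [E(K):ℤP]` at ONE S0 datum of an X11b@3 curve
(`ρ̄_{E,3}` onto) from UB∃ᴮ@3 + `Three.BDPValueAt₃ W` + PUBLISHED facts** (`h331` = JSW17 Thm. 3.3.1 at a multiplicative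
`p ≥ 3`; `hKo` = Kolyvagin: rank one and finiteness). Pick any degree-one `𝔭 ∋ 3` (3 splits in the Heegner field since
`3 ∣ N`); UB∃ᴮ@3 gives `ι'` inducing `𝔭`, a frame `L` at `(ι', 𝔭)` for the newform `Dt.f`, and `(L) ⊆ Ch_Λ(X_ac 𝔭₁)·R₀⟦T⟧`
at the other prime `𝔭₁` (`Three.exists_ne_degreeOne_prime`); H2@3 gives `L(𝟙) = u·((1 − a₃/3)·log_𝔭 P)²` (`u ∈ R₀ˣ`);
read both in `𝓞_{ℂ_3}⟦T⟧` and apply p524850's `charValuation_le_of_span_le_of_intValue` with the control identity at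
`(𝔭₁, embAt 𝔭₁, P)` (`controlOnTreeAt_of_thm331Mult_embAt`; `E[3]` irreducible over `G_K` by `irrK_of_surj`) and the
rank-one log symmetry `log_𝔭 P ↦ log_{𝔭₁} P`; then §0. CONDITIONAL on UB∃ᴮ@3 (sourceless at 3) and H2@3.
[cite: JetchevSkinnerWan2017, Thm. 3.3.1 with §3.5 (3.5.c) and §7.4.2 (arXiv:1512.06894 pp. 11, 15, 31)]
[cite: Castella2018, Thms. 2.3, 3.1, 3.2 and §5 (5.2) (arXiv:1704.06608 pp. 5, 9, 12)] [cite: Kolyvagin1990, Thm. A] -/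
theorem shaIndexBoundSharp_of_ubB₃_at_datum
    (h331 : thm331_anticyclotomicControl_mult)
    (hKo : ∀ (N : ℕ) [NeZero N] (W : WeierstrassCurve ℚ) (K : Type) [Field K] [NumberField K],
      kolyvagin N W K)
    -- H2@3 at the curve (a theorem from the LZZ fact: `Three.bdpValueAt₃_of_thm151_thm153`)
    (hVal : Three.BDPValueAt₃ W)
    -- UB∃ᴮ@3 at the curve: `Three.BDPExistsAt₃` with the REVERSED inclusion of `Three.IMCDivAt₃B` attached
    (hUB : ∀ (N : ℕ) [NeZero N] (K : Type) [Field K] [NumberField K] (Dt : ModularParametrizationData W N)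
      (H : HeegnerDatum N (NumberField.discr K)) (ι : K →+* ℂ) (P : (W.baseChange K).toAffine.Point),
      ClassX11b W 3 → Surj W 3 → W.conductorNorm ℤ = N → IsImaginaryQuadratic K →
      Odd (NumberField.discr K) → SatisfiesHeegnerHypothesis N K →
      (W.quadraticTwist (NumberField.discr K : ℚ)).entireLFunction 1 ≠ 0 →
      WeierstrassCurve.Affine.Point.map ι.toRatAlgHom P = heegnerPointComplex Dt H →
      ¬ (3 : ℤ) ∣ Dt.c → ¬ IsOfFinAddOrder P →
      ∀ (κ : ZpExtension K 3), κ.IsAnticyclotomic →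
        ∀ (γ : Field.absoluteGaloisGroup K) [Fact (κ.IsTopGenerator γ)]
          (𝔭 : HeightOneSpectrum (𝓞 K)), ((3 : ℕ) : 𝓞 K) ∈ 𝔭.asIdeal →
          𝔭.asIdeal.ramificationIdx (𝓞 ℚ) = 1 → 𝔭.asIdeal.inertiaDeg (𝓞 ℚ) = 1 →
          ∀ (f : CuspForm (CongruenceSubgroup.Gamma0 N) 2), IsNewformOf W f →
            ∃ ι' : PadicAlgCl 3 ≃+* ℂ, InducesPrime ι' 𝔭 ∧
              ∃ (ΩK : ℂ) (Ωp : (unrIntegers 3)ˣ) (L : UnrSeries 3),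
                ΩK ≠ 0 ∧ IsBDPLFunction ι' 𝔭 κ γ f ΩK ((Ωp : unrIntegers 3) : ℂ_[3]) L ∧
                ∀ (𝔭bar : HeightOneSpectrum (𝓞 K)), ((3 : ℕ) : 𝓞 K) ∈ 𝔭bar.asIdeal → 𝔭bar ≠ 𝔭 →
                  Ideal.span {L} ≤
                    (XAc.charIdeal (W.baseChange K) 3 κ 𝔭bar ∅ γ).map (PowerSeries.map (toUnr 3)))
    -- the datum
    (N : ℕ) [NeZero N] (K : Type) [Field K] [NumberField K]
    (Dt : ModularParametrizationData W N) (H : HeegnerDatum N (NumberField.discr K)) (ιK : K →+* ℂ)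
    (P : (W.baseChange K).toAffine.Point)
    (hX : ClassX11b W 3) (hsurj : Surj W 3) (hN : W.conductorNorm ℤ = N)
    (hK : IsImaginaryQuadratic K) (hodd : Odd (NumberField.discr K)) (hHN : SatisfiesHeegnerHypothesis N K)
    (hLt : (W.quadraticTwist (NumberField.discr K : ℚ)).entireLFunction 1 ≠ 0)
    (hP : WeierstrassCurve.Affine.Point.map ιK.toRatAlgHom P = heegnerPointComplex Dt H)
    (hc : ¬ (3 : ℤ) ∣ Dt.c) (hPinf : ¬ IsOfFinAddOrder P) :
    padicValNat 3 (W.baseChange K).shaOrder + 2 * padicValNat 3 W.tamagawaProduct ≤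
      2 * padicValNat 3 (AddSubgroup.zmultiples P).index := by
  have hX' := hX
  obtain ⟨-, -, hmult, -⟩ := hX
  have hp : (3 : ℕ).Prime := Fact.out
  have hp2 : (3 : ℕ) ≠ 2 := by norm_num
  -- Kolyvagin: `rank_ℤ E(K) = 1`, `#Ш(E/K) < ∞`
  obtain ⟨hrk, hfinK⟩ := hKo N W K hK hHN ⟨Dt, H, ιK, hP⟩ hPinf
  haveI : Finite (W.baseChange K).sha := hfinK
  have hfin : Finite (AddCommGroup.primaryComponent (W.baseChange K).sha 3) := inferInstance
  -- `3 ∣ N` splits in `K`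
  have hpN : 3 ∣ N := hN ▸ dvd_conductorNorm_of_mult hmult
  have hHp : SatisfiesHeegnerHypothesis 3 K := SatisfiesHeegnerHypothesis.of_dvd hpN hHN
  have hsplit : SplitsIn K 3 := hHN 3 hp hpN
  have hirrK : (W.baseChange K).HasIrreducibleModPGaloisRep 3 := irrK_of_surj W 3 hsurj K hK.1
  -- anticyclotomic `(κ, γ)` and a degree-one prime `𝔭 ∋ 3`
  obtain ⟨κ, γ, 𝔭, hκ, hγ, h𝔭⟩ := exists_anticyclotomic_generator_prime (p := 3) hK
  haveI : Fact (κ.IsTopGenerator γ) := ⟨hγ⟩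
  obtain ⟨he, hf⟩ := degreeOne_of_splitsIn hK.1 hsplit h𝔭
  -- UB∃ᴮ@3: the embedding datum, the frame and the Euler-system inclusion at every other prime
  obtain ⟨ι', hι', ΩK, Ωp, L, hΩK, hL, hUBall⟩ :=
    hUB N K Dt H ιK P hX' hsurj hN hK hodd hHN hLt hP hc hPinf κ hκ γ 𝔭 h𝔭 he hf Dt.f Dt.isNewformOf
  -- H2@3 at that frame: the value at `𝟙`, read through `embAt 𝔭` at `P`
  obtain ⟨u, hu⟩ := hVal N K Dt H ιK P hX' hsurj hN hK hodd hHN hLt hP hc hPinf κ hκ γ 𝔭 h𝔭 he hf Dt.f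
    Dt.isNewformOf ι' hι' ΩK Ωp L hΩK hL
  -- the OTHER degree-one prime `𝔭₁` above `3`: the X-slot
  obtain ⟨𝔭₁, hne, h𝔭₁, he₁, hf₁⟩ := Three.exists_ne_degreeOne_prime hK.1 (p := 3) h𝔭 he hf
  have hUB₁ := hUBall 𝔭₁ h𝔭₁ hne
  -- read frame, inclusion and value in `𝓞_{ℂ_3}⟦T⟧`
  have hUB₁' : Ideal.span {PowerSeries.map (R1.unrToCpInt 3) L} ≤
      (XAc.charIdeal (W.baseChange K) 3 κ 𝔭₁ ∅ γ).map (PowerSeries.map (R1.toCpInt 3)) := by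
    have h := Ideal.map_mono (f := PowerSeries.map (R1.unrToCpInt 3)) hUB₁
    rwa [map_span_singleton_powerSeries, Ideal.map_map, ← R1.map_toCpInt_eq_comp] at h
  have hu' : IntSeries.HasValueAt (PowerSeries.map (R1.unrToCpInt 3) L) 0
      (((u : unrIntegers 3) : ℂ_[3]) *
        (algebraMap ℚ_[3] ℂ_[3] (((1 : ℚ_[3]) - ((W.LFunction 3 : ℤ) : ℚ_[3]) * (3 : ℚ_[3])⁻¹) *
          logOmega W 3 (embAt K 3 𝔭 h𝔭 he hf) P)) ^ 2) :=
    (R1.intSeries_hasValueAt_map_iff 3 L _ _).mpr hu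
  have hu1 : ‖((u : unrIntegers 3) : ℂ_[3])‖ = 1 := norm_coe_units_unrIntegers 3 u
  -- the control IDENTITY at `(𝔭₁, embAt 𝔭₁, P)` from the JSW fact
  have hCTL : ControlOnTreeAt 3 κ 𝔭₁ γ (embAt K 3 𝔭₁ h𝔭₁ he₁ hf₁) P :=
    controlOnTreeAt_of_thm331Mult_embAt h331 le_rfl hmult hK hHp hirrK κ hκ γ 𝔭₁ h𝔭₁ he₁ hf₁ hrk hfin P hPinf
  obtain ⟨n, hn, -⟩ := id hCTL
  -- UB ∘ value at `𝟙`: `ord₃ f_ac(0) ≤ 2·(ord₃ log_𝔭 P − 1)`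
  have ha : ¬ ((3 : ℕ) : ℤ) ∣ W.LFunction 3 := R1.not_dvd_lFunction_of_mult Dt.isNewformOf hmult
  have hle₀ : (n : ℤ) ≤ 2 * (X11b.padicLogOrd W 3 (embAt K 3 𝔭 h𝔭 he hf) P - 1) :=
    charValuation_le_of_span_le_of_intValue hn hUB₁' hu1 ha hPinf hu'
  -- rank-one log symmetry `log_𝔭 P ↦ log_{𝔭₁} P`
  have hsymm : X11b.padicLogOrd W 3 (embAt K 3 𝔭₁ h𝔭₁ he₁ hf₁) P =
      X11b.padicLogOrd W 3 (embAt K 3 𝔭 h𝔭 he hf) P := by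
    obtain ⟨ρ, -, hρρ, happ⟩ := exists_algEquiv_embAt_eq_comp (p := 3) hK.1 h𝔭 he hf h𝔭₁ he₁ hf₁ hne
    have hcompρ : (embAt K 3 𝔭 h𝔭 he hf).comp (ρ : K →+* K) = embAt K 3 𝔭₁ h𝔭₁ he₁ hf₁ :=
      RingHom.ext fun x => (happ x).symm
    rw [← hcompρ, ← R1.padicLogOrd_map_eq_comp]
    exact R1.padicLogOrd_map_eq_of_rank_one W 3 _ P hp2 (ρ : K →+* K) (fun x => hρρ x) hrk hPinf
  have hle : (n : ℤ) ≤ 2 * (X11b.padicLogOrd W 3 (embAt K 3 𝔭₁ h𝔭₁ he₁ hf₁) P - 1) := by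
    rw [hsymm]; exact hle₀
  exact shaIndexBoundSharp_of_heegner_prime hK hN hHN hn hle hCTL

end Datum

/-! ### §2 X11b@3 ∧ (ram): both (ram) clauses of the crux from UB∃ᴮ@3 + H2@3 + published facts -/

section Ram

/-- **`Typed.MissingUpperBoundAt W 3` on X11b@3 ∧ (ram) from UB∃ᴮ@3 + H2@3 and PUBLISHED facts — NO Tamagawa condition,
whatever the shape (α ∕ β ∕ γ) and the carrier count.** The odd-`d_K` Manin-good Heegner datum (`exists_oddHeegnerData`
at `p = 3`); `ρ̄_{E,3}` onto from (irr) + (ram); §1; the twist on its minimal model is multiplicative ∧ irreducible ∧ (ram)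
at `3` with `L(E^{d_K},1) ≠ 0`, so Skinner 2016 Thm. C (`hSk`, `p ≥ 3`) gives the `≥`-half of its `3`-part; the ℚ-descent
`missingUpperBoundAt_of_shaIndexBoundSharp_of_odd` (p524850). CONDITIONAL on UB∃ᴮ@3 (sourceless at 3) and H2@3.
[cite: JetchevSkinnerWan2017, Thm. 3.3.1 and §7.4.2 (arXiv:1512.06894 pp. 11, 31)]
[cite: Skinner2016PacificMC, Thm. C (§1) and footnote 1] [cite: HoffsteinLuo1997, Theorem (§1)]
[cite: Mazur1978, Cor. 4.1] [cite: Miller2011LMS, Def. 1.1 (arXiv:1010.2431 p. 3)] -/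
theorem missingUpperBoundAt_three_of_classX11b_of_ram_of_ubB₃
    (h331 : thm331_anticyclotomicControl_mult)
    (hGZ : ∀ (N : ℕ) [NeZero N] (W : WeierstrassCurve ℚ) (K : Type) [Field K] [NumberField K],
      gross_zagier N W K)
    (hKo : ∀ (N : ℕ) [NeZero N] (W : WeierstrassCurve ℚ) (K : Type) [Field K] [NumberField K],
      kolyvagin N W K)
    (hSk : Skinner2016.thmC_padicValRat_bsd_rank_zero)
    (hGZK : rank_eq_analyticRank_of_analyticRank_le_one) (hmod : hasEntireLFunction_rat)
    (hnf : exists_isNewformOf) (hHL : HoffsteinLuo1997_exists_twist_L_one_ne_zero)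
    (hMaz : mazur_not_dvd_maninConstant_of_odd)
    (W : WeierstrassCurve ℚ) [W.IsElliptic] [W.IsGloballyMinimal]
    (hX : ClassX11b W 3) (hram : Ram W 3) (hVal : Three.BDPValueAt₃ W)
    (hUB : ∀ (N : ℕ) [NeZero N] (K : Type) [Field K] [NumberField K] (Dt : ModularParametrizationData W N)
      (H : HeegnerDatum N (NumberField.discr K)) (ι : K →+* ℂ) (P : (W.baseChange K).toAffine.Point),
      ClassX11b W 3 → Surj W 3 → W.conductorNorm ℤ = N → IsImaginaryQuadratic K →
      Odd (NumberField.discr K) → SatisfiesHeegnerHypothesis N K →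
      (W.quadraticTwist (NumberField.discr K : ℚ)).entireLFunction 1 ≠ 0 →
      WeierstrassCurve.Affine.Point.map ι.toRatAlgHom P = heegnerPointComplex Dt H →
      ¬ (3 : ℤ) ∣ Dt.c → ¬ IsOfFinAddOrder P →
      ∀ (κ : ZpExtension K 3), κ.IsAnticyclotomic →
        ∀ (γ : Field.absoluteGaloisGroup K) [Fact (κ.IsTopGenerator γ)]
          (𝔭 : HeightOneSpectrum (𝓞 K)), ((3 : ℕ) : 𝓞 K) ∈ 𝔭.asIdeal →
          𝔭.asIdeal.ramificationIdx (𝓞 ℚ) = 1 → 𝔭.asIdeal.inertiaDeg (𝓞 ℚ) = 1 →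
          ∀ (f : CuspForm (CongruenceSubgroup.Gamma0 N) 2), IsNewformOf W f →
            ∃ ι' : PadicAlgCl 3 ≃+* ℂ, InducesPrime ι' 𝔭 ∧
              ∃ (ΩK : ℂ) (Ωp : (unrIntegers 3)ˣ) (L : UnrSeries 3),
                ΩK ≠ 0 ∧ IsBDPLFunction ι' 𝔭 κ γ f ΩK ((Ωp : unrIntegers 3) : ℂ_[3]) L ∧
                ∀ (𝔭bar : HeightOneSpectrum (𝓞 K)), ((3 : ℕ) : 𝓞 K) ∈ 𝔭bar.asIdeal → 𝔭bar ≠ 𝔭 →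
                  Ideal.span {L} ≤
                    (XAc.charIdeal (W.baseChange K) 3 κ 𝔭bar ∅ γ).map (PowerSeries.map (toUnr 3))) :
    Typed.MissingUpperBoundAt W 3 := by
  have hNS : integral_neronScaling_of_isGloballyMinimal := integral_neronScaling_of_isGloballyMinimal_holds
  have hX' := hX
  obtain ⟨hr, hp2, hmult, hirr⟩ := hX
  haveI : NeZero (W.conductorNorm ℤ) := ⟨(W.conductorNorm_pos_holds).ne'⟩
  obtain ⟨K, _, _, Dt, H, ι, P, Wd, _, _, Cd, hK, hodd, hpd, hHN, hP, hc, hμ, hLt, hWd⟩ :=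
    exists_oddHeegnerData hnf hHL hMaz hNS W 3 hr hp2 hmult hirr
  have hsurj : Surj W 3 := surj_of_irr_of_ram W 3 hirr hram
  -- the twist on its minimal model: transports, `L(E^D,1) ≠ 0`, finiteness, Skinner 2016 Thm. C at `p = 3`
  have hD0 : (NumberField.discr K : ℚ) ≠ 0 := by exact_mod_cast NumberField.discr_ne_zero K
  haveI hEt : (W.quadraticTwist (NumberField.discr K : ℚ)).IsElliptic := W.isElliptic_quadraticTwist hD0
  have hmultd : Wd.HasMultiplicativeReductionAtPrime 3 :=
    hasMultiplicativeReductionAtPrime_twist_of_heegner' W 3 K hK hHN hmult Cd hWd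
  have hirrd : Wd.HasIrreducibleModPGaloisRep 3 :=
    hasIrreducibleModPGaloisRep_twist_model W 3 K hK.1 hirr Cd hWd
  have hramd : Ram Wd 3 := ram_twist_of_heegner W 3 K hK hHN hram Cd hWd
  have hLt' : (W.quadraticTwist (NumberField.discr K : ℚ)).entireLFunction = Wd.entireLFunction := by
    rw [← hWd, entireLFunction_smul]
  have hLd1 : Wd.entireLFunction 1 ≠ 0 := by rw [← hLt']; exact hLt
  have hrd : Wd.analyticRank = 0 := (Wd.analyticRank_eq_zero_iff_holds (hmod Wd)).2 hLd1
  have hfinSd : Finite Wd.sha := (hGZK Wd (by omega)).2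
  obtain ⟨qd, hqd, hvqd⟩ := hSk Wd 3 le_rfl (Or.inr hmultd) hirrd hramd hLd1 hfinSd
  have hPinf : ¬ IsOfFinAddOrder P :=
    not_isOfFinAddOrder_of_heegner_of_analyticRank_eq_one W _ K Dt H ι P (hGZ _ W K) hmod hr hK hHN hLt hP
  exact missingUpperBoundAt_of_shaIndexBoundSharp_of_odd W 3 K Dt H ι P (hGZ _ W K) (hKo _ W K) hGZK hmod
    hr hp2 hmult hK hodd hpd hHN hP hc hμ hLt Wd Cd hWd ⟨qd, hqd, hvqd.le⟩
    (fun _ _ ↦ shaIndexBoundSharp_of_ubB₃_at_datum h331 hKo hVal hUB _ K Dt H ι P hX' hsurj rfl hK hodd hHN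
      hLt hP hc hPinf)

end Ram

end Summit.BirchSwinnertonDyer.BirchSwinnertonDyer.Theorems.EulerHalfUB

end
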